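import Summits.NavierStokesRegularity.OSWSelfSimilar.OSWMechanismGlobalBranch03
import HarnessLib

/-!
# OSW self-similar mechanism, companion module (MECHANISM.md §§29–34: THEOREMS M32–M39) — part 04 of 09

1-D model (gCLM/OSW), computer-assisted; not Euler/NS.  Filed under `Summits/NavierStokesRegularity/OSWSelfSimilar/` by a prover-role courier on behalf of the
mechanism seat pub-oswblow-mech (planner-pub-oswblow-mech-g29-0), cell pub-oswblow (host summit NavierStokesRegularity); the gate admits the path but
not role planner.  CONTENT = the staged transcript `pub-oswblow-mech/lean/OSWMechanismGlobalBranch.lean` (sha256 4e5de3f87ec94598…,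
2998 lines), source lines 1111–1477, UNCHANGED except: (i) namespace prefix `OSWSelfSimilar.Mechanism` → `Summit.NavierStokesRegularity.OSWSelfSimilar.Mechanism`;
(ii) the frames open at the cut (section (anonymous) › namespace Summit.NavierStokesRegularity.OSWSelfSimilar.Mechanism.ChordSlope) are re-opened above the body with their `open` commands replayed, and closed
at the end; (iii) this docstring.  Generated by `pub-oswblow-mech/lean/courier/make_split.py`; the parts must be filed IN ORDER
(each imports its predecessor).  First/last declarations here: `_root_.Summit.NavierStokesRegularity.OSWSelfSimilar.Mechanism.GlobalBranch.BranchFamily.sink_to_zero` … `x0_sq_lt` (32 in this part).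
AI-written transcript; kernel-checked on the farm as ONE file before splitting (see the kit's CHECKS); to be checked, not trusted.
COURIER NOTE (prover-role courier seat pub-oswblow-courier g2, 2026-08-25): in addition to the changes listed above, 4 one-line docstrings were added at filing on the declarations the transcript left undocumented (tree docstring rule); each only restates the formal statement of its declaration; nothing else was touched. List of the added docstrings: HOME `pub-oswblow-courier/g2/DOCSTRINGS.tsv`.
-/

noncomputable section
open Complex Set Filter
open scoped Topology
open Literature.Analysis.FluidPDE.OkamotoSakajoWunsch2008
namespace Summit.NavierStokesRegularity.OSWSelfSimilar.Mechanism.ChordSlope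
open Summit.NavierStokesRegularity.OSWSelfSimilar.Mechanism.GlobalBranch

/-- **COROLLARY 30.6 (a), first step, KERNEL-CHECKED:** divergence of the chord slope and an a-priori chord bound on
`{B₀ ≥ b}` (eventually along the family) force `B₀(σ) → 0`. -/
theorem _root_.Summit.NavierStokesRegularity.OSWSelfSimilar.Mechanism.GlobalBranch.BranchFamily.sink_to_zero {NegP : ℝ → (ℤ → ℂ) → Prop} {β : NNReal} {aσ : ℝ → ℝ} {cσ : ℝ → ℤ → ℂ}
    (_hF : BranchFamily NegP β aσ cσ) (hdiv : ChordSlopeDiverges aσ cσ)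
    (hΨ : ∀ b : ℝ, 0 < b → ∃ C σ₁ : ℝ, ∀ σ : ℝ, σ₁ < σ → 0 < σ → b ≤ -HfR (cσ σ) Real.pi →
      ChordBound (cσ σ) (C / (1 - aσ σ))) :
    ∀ b : ℝ, 0 < b → ∃ σ₀ : ℝ, ∀ σ : ℝ, σ₀ < σ → 0 < σ → -HfR (cσ σ) Real.pi < b := by
  intro b hb
  obtain ⟨C, σ₁, hC⟩ := hΨ b hb
  obtain ⟨σU, hσU⟩ := hdiv C
  refine ⟨max σU σ₁, fun σ hσ hσ0 => ?_⟩
  have hσU' : σU < σ := lt_of_le_of_lt (le_max_left _ _) hσ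
  have hσ1' : σ₁ < σ := lt_of_le_of_lt (le_max_right _ _) hσ
  by_contra hcon
  exact hσU σ hσU' (hC σ hσ1' hσ0 (not_lt.mp hcon))

/-- **COROLLARY 30.6 (a), second step, KERNEL-CHECKED:** `B₀ → 0` along a branch family forces `sup p = ∞`. -/
theorem _root_.Summit.NavierStokesRegularity.OSWSelfSimilar.Mechanism.GlobalBranch.BranchFamily.p_unbounded {NegP : ℝ → (ℤ → ℂ) → Prop} {β : NNReal} {aσ : ℝ → ℝ} {cσ : ℝ → ℤ → ℂ}
    (hF : BranchFamily NegP β aσ cσ)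
    (hz : ∀ b : ℝ, 0 < b → ∃ σ₀ : ℝ, ∀ σ : ℝ, σ₀ < σ → 0 < σ → -HfR (cσ σ) Real.pi < b) :
    ∀ M : ℝ, ∃ σ : ℝ, 0 < σ ∧ M < branchP aσ cσ σ := by
  apply p_unbounded_of_sink_to_zero aσ (fun σ => -HfR (cσ σ) Real.pi) (branchP aσ cσ)
  · intro σ hσ; have := hF.window σ hσ; exact ⟨by linarith [this.1], this.2⟩
  · intro σ hσ; linarith [hF.sink σ hσ]
  · intro σ _; unfold branchP; rw [one_div_neg_eq_neg_one_div]; ring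
  · exact hz

/-- **COROLLARY 30.6 (a), KERNEL-CHECKED:** along a branch family with divergent chord slope, an a-priori chord bound at
`B₀ ≥ b` (eventually) puts EVERY odd rung `P = 2n+3` on the branch (via `BranchFamily.rung`). -/
theorem _root_.Summit.NavierStokesRegularity.OSWSelfSimilar.Mechanism.GlobalBranch.BranchFamily.ladder_of_slope_bound {NegP : ℝ → (ℤ → ℂ) → Prop} {β : NNReal} {aσ : ℝ → ℝ} {cσ : ℝ → ℤ → ℂ}
    (hF : BranchFamily NegP β aσ cσ) (hdiv : ChordSlopeDiverges aσ cσ)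
    (hΨ : ∀ b : ℝ, 0 < b → ∃ C σ₁ : ℝ, ∀ σ : ℝ, σ₁ < σ → 0 < σ → b ≤ -HfR (cσ σ) Real.pi →
      ChordBound (cσ σ) (C / (1 - aσ σ))) (n : ℕ) :
    ∃ σ : ℝ, 0 < σ ∧ NegP (aσ σ) (cσ σ) ∧ (1 - aσ σ) * HfR (cσ σ) 0 = 1 ∧
      HfR (cσ σ) Real.pi = -(1 / (aσ σ * (2 * (n : ℝ) + 3) - 1)) :=
  hF.rung (hF.p_unbounded (hF.sink_to_zero hdiv hΨ)) n

/-- **QUESTION 30.10 (a), typed — OPEN (the a-priori bound (30.7), QUESTION 29.8 sharpened and freed of windows):**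
`(1−a)·sup F/sin x ≤ Ψ(b)` for every negative simple-source profile with `|Hf(π)| ≥ b`.  NOT used as a hypothesis
anywhere except by name (`ladder_of_slope_apriori`). -/
def SlopeAprioriConjecture (NegP : ℝ → (ℤ → ℂ) → Prop) : Prop :=
  ∀ b : ℝ, 0 < b → ∃ C : ℝ, ∀ (a : ℝ) (c : ℤ → ℂ), NegP a c → (1 - a) * HfR c 0 = 1 → 3 / 5 < a → a < 1 →
    b ≤ -HfR c Real.pi → ChordBound c (C / (1 - a))

/-- COROLLARY 30.6 (a) in its headline form (KERNEL-CHECKED reduction): M33's divergence + the conjectured a-priori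
bound ⇒ every rung of the ladder lies on the branch. -/
theorem _root_.Summit.NavierStokesRegularity.OSWSelfSimilar.Mechanism.GlobalBranch.BranchFamily.ladder_of_slope_apriori {NegP : ℝ → (ℤ → ℂ) → Prop} {β : NNReal} {aσ : ℝ → ℝ} {cσ : ℝ → ℤ → ℂ}
    (hF : BranchFamily NegP β aσ cσ) (hdiv : ChordSlopeDiverges aσ cσ) (hQ : SlopeAprioriConjecture NegP) (n : ℕ) :
    ∃ σ : ℝ, 0 < σ ∧ NegP (aσ σ) (cσ σ) ∧ (1 - aσ σ) * HfR (cσ σ) 0 = 1 ∧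
      HfR (cσ σ) Real.pi = -(1 / (aσ σ * (2 * (n : ℝ) + 3) - 1)) := by
  apply hF.ladder_of_slope_bound hdiv _ n
  intro b hb
  obtain ⟨C, hC⟩ := hQ b hb
  exact ⟨C, 0, fun σ _ hσ0 hB => hC (aσ σ) (cσ σ) (hF.profile σ hσ0) (hF.source σ hσ0)
    (hF.window σ hσ0).1 (hF.window σ hσ0).2 hB⟩

/-- The log-concave shape class `𝒮_LC`, typed on `u = F/sin x`: positive, non-increasing and log-concave on `(0,π)`. -/
def InSLC (c : ℤ → ℂ) : Prop :=
  (∀ x ∈ Set.Ioo 0 Real.pi, 0 < -fR c x) ∧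
  AntitoneOn (fun x => -fR c x / Real.sin x) (Set.Ioo 0 Real.pi) ∧
  ConcaveOn ℝ (Set.Ioo 0 Real.pi) (fun x => Real.log (-fR c x / Real.sin x))

/-- **THEOREM 30.7, typed (PROVED pen-and-paper, via THEOREM M31 (§28) and LEMMA 30.4 (b); the envelope algebra is
`slope_bound_LC_alg`): (29.10) HOLDS IN `𝒮_LC`** — for `a ≤ a₂ < 1` and `|Hf(π)| ≥ b > 0` the chord slope
(`= |f′(0)|` in `𝒮`) is bounded by `𝒩(b,a₂)`. -/
def SlopeBoundLCStatement (NegP : ℝ → (ℤ → ℂ) → Prop) : Prop :=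
  ∀ a₂ b : ℝ, 3 / 5 < a₂ → a₂ < 1 → 0 < b → ∃ C : ℝ, ∀ (a : ℝ) (c : ℤ → ℂ), NegP a c → (1 - a) * HfR c 0 = 1 →
    3 / 5 < a → a ≤ a₂ → b ≤ -HfR c Real.pi → InSLC c → ChordBound c C

/-- **COROLLARY 30.6 (b), KERNEL-CHECKED:** along a branch family with divergent chord slope which is eventually in `𝒮_LC`
with `a ≤ a₂ < 1`, THEOREM 30.7 puts every odd rung on the branch. -/
theorem _root_.Summit.NavierStokesRegularity.OSWSelfSimilar.Mechanism.GlobalBranch.BranchFamily.ladder_in_LC {NegP : ℝ → (ℤ → ℂ) → Prop} {β : NNReal} {aσ : ℝ → ℝ} {cσ : ℝ → ℤ → ℂ}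
    (hF : BranchFamily NegP β aσ cσ) (hdiv : ChordSlopeDiverges aσ cσ) (hT : SlopeBoundLCStatement NegP)
    (a₂ σ₁ : ℝ) (ha₂ : 3 / 5 < a₂) (ha₂' : a₂ < 1)
    (hev : ∀ σ : ℝ, σ₁ < σ → 0 < σ → aσ σ ≤ a₂ ∧ InSLC (cσ σ)) (n : ℕ) :
    ∃ σ : ℝ, 0 < σ ∧ NegP (aσ σ) (cσ σ) ∧ (1 - aσ σ) * HfR (cσ σ) 0 = 1 ∧
      HfR (cσ σ) Real.pi = -(1 / (aσ σ * (2 * (n : ℝ) + 3) - 1)) := by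
  apply hF.ladder_of_slope_bound hdiv _ n
  intro b hb
  obtain ⟨C, hC⟩ := hT a₂ b ha₂ ha₂' hb
  refine ⟨|C|, σ₁, fun σ hσ hσ0 hB => ?_⟩
  have hwin := hF.window σ hσ0
  obtain ⟨ha, hS⟩ := hev σ hσ hσ0
  have hcb : ChordBound (cσ σ) C :=
    hC (aσ σ) (cσ σ) (hF.profile σ hσ0) (hF.source σ hσ0) hwin.1 ha hB hS
  apply chordBound_mono hcb
  have h1a : 0 < 1 - aσ σ := by linarith [hwin.2]
  have h1b : 1 - aσ σ ≤ 1 := by linarith [hwin.1]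
  calc C ≤ |C| := le_abs_self C
    _ = |C| / 1 := (div_one _).symm
    _ ≤ |C| / (1 - aσ σ) := div_le_div_of_nonneg_left (abs_nonneg C) h1a h1b

/-- **The v24 bundle of this module's §30 block:** LEMMA 30.1 (c) ∧ THEOREM 30.3 ∧ THEOREM 30.7 ∧ (M32 + exclusions), all
typed shadows, parametric in `NegP`; `SlopeAprioriConjecture` stays OUTSIDE the bundle (open). -/
def ChordSlopeBundle (NegP : ℝ → (ℤ → ℂ) → Prop) : Prop :=
  HolderFromChordStatement NegP ∧ RigidityAtDGStatement NegP ∧ SlopeBoundLCStatement NegP ∧ GlobalBranchV24Statement NegP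

/-- v24 headline reduction (kernel-checked): the bundle gives M33's divergence on a branch family for every `β`, and
WITH the open a-priori bound every rung on it. -/
theorem ladder_of_v24 {NegP : ℝ → (ℤ → ℂ) → Prop} (h : ChordSlopeBundle NegP) (hQ : SlopeAprioriConjecture NegP) :
    ∀ β : NNReal, 0 < β → β < 1 → ∃ (aσ : ℝ → ℝ) (cσ : ℝ → ℤ → ℂ), BranchFamily NegP β aσ cσ ∧
      ChordSlopeDiverges aσ cσ ∧
      ∀ n : ℕ, ∃ σ : ℝ, 0 < σ ∧ NegP (aσ σ) (cσ σ) ∧ (1 - aσ σ) * HfR (cσ σ) 0 = 1 ∧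
        HfR (cσ σ) Real.pi = -(1 / (aσ σ * (2 * (n : ℝ) + 3) - 1)) := by
  intro β hβ0 hβ1
  obtain ⟨aσ, cσ, hF, hdiv⟩ := chordSlopeDivergence_of h.2.2.2 h.1 β hβ0 hβ1
  exact ⟨aσ, cσ, hF, hdiv, fun n => hF.ladder_of_slope_apriori hdiv hQ n⟩

end Summit.NavierStokesRegularity.OSWSelfSimilar.Mechanism.ChordSlope


/-! ## §31 (v25): the source defect — LEMMA 31.1 ([HQWW23, §2] on 𝕋), LEMMA 31.2, THEOREM M34 (no needle in 𝒮),
THEOREM M35 ((29.10) in 𝒮₁), COROLLARY 31.5, REMARK 31.6, QUESTION 31.7 (MECHANISM.md v25 §31).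
1-D model (gCLM/OSW), computer-assisted; not Euler/NS. -/

namespace Summit.NavierStokesRegularity.OSWSelfSimilar.Mechanism.SourceDefect

open Summit.NavierStokesRegularity.OSWSelfSimilar.Mechanism.GlobalBranch Summit.NavierStokesRegularity.OSWSelfSimilar.Mechanism.ChordSlope

/-! ### LEMMA 31.1: the algebra of the defect formula -/

/-- `(1−a)A₀ = 1` (q₀ = 1) ⇒ the exponent `(1/a)(1 − 1/A₀) = 1` with which `x` enters the defect formula. -/
theorem defect_exponent (a A0 : ℝ) (hq : (1 - a) * A0 = 1) (ha : a ≠ 0) :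
    (1 / a) * (1 - 1 / A0) = 1 := by
  have hA0 : A0 ≠ 0 := by rintro rfl; simp at hq
  field_simp
  linarith [hq]

/-- `A₀ − 1 = aA₀` under `(1−a)A₀ = 1`. -/
theorem A0_sub_one (a A0 : ℝ) (hq : (1 - a) * A0 = 1) : A0 - 1 = a * A0 := by linarith [hq]

/-- (31.1): the local exponent `γ = x(h−1)/(ag)` with `h = A₀ − η`, `g = A₀x(1−ε)` equals `(1 − η/(aA₀))/(1 − ε)`. -/
theorem localExponent_eq (a A0 η ε x : ℝ) (hq : (1 - a) * A0 = 1) (ha : 0 < a) (hA : 0 < A0)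
    (hε : ε < 1) (hx : 0 < x) :
    x * ((A0 - η) - 1) / (a * (A0 * x * (1 - ε))) = (1 - η / (a * A0)) / (1 - ε) := by
  have h1 : A0 - 1 = a * A0 := A0_sub_one a A0 hq
  have hε' : (1 - ε) ≠ 0 := by linarith
  field_simp
  ring_nf
  nlinarith [h1]

/-- Algebra (`0 < a`, `0 < A₀`, `ε < 1`): `1 − (1 − η/(aA₀))/(1 − ε) = (η/(aA₀) − ε)/(1 − ε)`. -/
theorem one_sub_localExponent (a A0 η ε : ℝ) (ha : 0 < a) (hA : 0 < A0) (hε : ε < 1) :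
    1 - (1 - η / (a * A0)) / (1 - ε) = (η / (a * A0) - ε) / (1 - ε) := by
  have hε' : (1 - ε) ≠ 0 := by linarith
  field_simp
  ring

/-- `ε = (A₀x − g)/(A₀x)`: with `g = A₀x(1−ε)` this is an identity. -/
theorem deficit_identity (A0 x ε : ℝ) (hA : 0 < A0) (hx : 0 < x) :
    (A0 * x - A0 * x * (1 - ε)) / (A0 * x) = ε := by
  field_simp; ring

/-! ### THEOREM 31.3, STEP 1: the elementary inequalities for `ε ≤ 1/2` -/

/-- `−log(1 − ε) ≤ ε/(1 − ε)` for `0 ≤ ε < 1`. -/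
theorem neg_log_one_sub_le (ε : ℝ) (_h0 : 0 ≤ ε) (h1 : ε < 1) :
    -Real.log (1 - ε) ≤ ε / (1 - ε) := by
  have hpos : 0 < 1 - ε := by linarith
  have := Real.log_le_sub_one_of_pos (inv_pos.mpr hpos)
  rw [Real.log_inv] at this
  have hinv : (1 - ε)⁻¹ - 1 = ε / (1 - ε) := by field_simp; ring
  linarith [hinv]

/-- `−log(1 − ε) ≤ 2ε` for `0 ≤ ε ≤ 1/2`. -/
theorem neg_log_one_sub_le_two_mul (ε : ℝ) (h0 : 0 ≤ ε) (h1 : ε ≤ 1 / 2) :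
    -Real.log (1 - ε) ≤ 2 * ε := by
  have h := neg_log_one_sub_le ε h0 (by linarith)
  have hpos : 0 < 1 - ε := by linarith
  have : ε / (1 - ε) ≤ 2 * ε := by
    rw [div_le_iff₀ hpos]; nlinarith
  linarith

/-- `1/(1 − ε) ≤ 2` for `ε ≤ 1/2`. -/
theorem inv_one_sub_le_two (ε : ℝ) (h1 : ε ≤ 1 / 2) : 1 / (1 - ε) ≤ 2 := by
  have hpos : 0 < 1 - ε := by linarith
  rw [div_le_iff₀ hpos]; linarith

/-! ### LEMMA 31.2: the cosine inequalities -/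

/-- Jordan-type lower bound: `cos s − cos t ≥ (2/π²)(t² − s²)` for `0 ≤ s ≤ t ≤ π/2`. -/
theorem cos_sub_cos_ge_jordan (s t : ℝ) (h0 : 0 ≤ s) (hst : s ≤ t) (ht : t ≤ Real.pi / 2) :
    2 / Real.pi ^ 2 * (t ^ 2 - s ^ 2) ≤ Real.cos s - Real.cos t := by
  have hπ := Real.pi_pos
  rw [Real.cos_sub_cos]
  -- cos s - cos t = -2 sin((s+t)/2) sin((s-t)/2) = 2 sin((s+t)/2) sin((t-s)/2)
  have e1 : -2 * Real.sin ((s + t) / 2) * Real.sin ((s - t) / 2)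
      = 2 * Real.sin ((s + t) / 2) * Real.sin ((t - s) / 2) := by
    rw [show (s - t) / 2 = -((t - s) / 2) by ring, Real.sin_neg]; ring
  rw [e1]
  have hA0 : 0 ≤ (s + t) / 2 := by linarith
  have hA1 : (s + t) / 2 ≤ Real.pi / 2 := by linarith
  have hB0 : 0 ≤ (t - s) / 2 := by linarith
  have hB1 : (t - s) / 2 ≤ Real.pi / 2 := by linarith
  have jA := Real.mul_le_sin hA0 hA1
  have jB := Real.mul_le_sin hB0 hB1
  have pA : 0 ≤ 2 / Real.pi * ((s + t) / 2) := by positivity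
  have pB : 0 ≤ 2 / Real.pi * ((t - s) / 2) := by positivity
  have prod := mul_le_mul jA jB pB (le_trans pA jA)
  have e2 : 2 / Real.pi * ((s + t) / 2) * (2 / Real.pi * ((t - s) / 2)) = (1 / Real.pi ^ 2) * (t ^ 2 - s ^ 2) := by
    field_simp; ring
  rw [e2] at prod
  have : 2 / Real.pi ^ 2 * (t ^ 2 - s ^ 2) = 2 * ((1 / Real.pi ^ 2) * (t ^ 2 - s ^ 2)) := by ring
  rw [this]
  nlinarith [prod]

/-- `cos s − cos y ≤ (y² − s²)/2` for `0 ≤ s ≤ y ≤ π` (from `sin x ≤ x`). -/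
theorem cos_sub_cos_le_half_sq_sub (s y : ℝ) (h0 : 0 ≤ s) (hsy : s ≤ y) (hy : y ≤ Real.pi) :
    Real.cos s - Real.cos y ≤ (y ^ 2 - s ^ 2) / 2 := by
  rw [Real.cos_sub_cos]
  have e1 : -2 * Real.sin ((s + y) / 2) * Real.sin ((s - y) / 2)
      = 2 * (Real.sin ((s + y) / 2) * Real.sin ((y - s) / 2)) := by
    rw [show (s - y) / 2 = -((y - s) / 2) by ring, Real.sin_neg]; ring
  rw [e1]
  have hA0 : 0 ≤ (s + y) / 2 := by linarith
  have hB0 : 0 ≤ (y - s) / 2 := by linarith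
  have sA : Real.sin ((s + y) / 2) ≤ (s + y) / 2 := Real.sin_le hA0
  have sB : Real.sin ((y - s) / 2) ≤ (y - s) / 2 := Real.sin_le hB0
  have nA : 0 ≤ Real.sin ((s + y) / 2) :=
    Real.sin_nonneg_of_nonneg_of_le_pi hA0 (by linarith)
  have nB : 0 ≤ Real.sin ((y - s) / 2) :=
    Real.sin_nonneg_of_nonneg_of_le_pi hB0 (by linarith)
  have := mul_le_mul sA sB nB hA0
  nlinarith [this]

/-- `1 − cos y ≥ (2/π²)y²` on `[0,π]` (Mathlib's `cos_le_one_sub_mul_cos_sq`). -/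
theorem one_sub_cos_ge (y : ℝ) (h0 : 0 ≤ y) (hy : y ≤ Real.pi) : 2 / Real.pi ^ 2 * y ^ 2 ≤ 1 - Real.cos y := by
  have := Real.cos_le_one_sub_mul_cos_sq (x := y) (by rw [abs_of_nonneg h0]; exact hy)
  linarith

/-- The exact weight of LEMMA 31.2 (L), (31.4): `(1 − cos y)·2cos²(y/2) = sin²y`. -/
theorem lower_weight_identity (y : ℝ) :
    (1 - Real.cos y) * (2 * Real.cos (y / 2) ^ 2) = Real.sin y ^ 2 := by
  have h1 : Real.cos (y / 2) ^ 2 = 1 / 2 + Real.cos y / 2 := by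
    rw [Real.cos_sq (y / 2)]; ring_nf
  linear_combination (2 * (1 - Real.cos y)) * h1 - Real.sin_sq_add_cos_sq y

/-- The numerical constant of LEMMA 31.2 (D): `π·(19/12 + (1+√2)/8) < 6` (= 5.922…). -/
theorem tu_coefficient_lt_six : Real.pi * (19 / 12 + (1 + Real.sqrt 2) / 8) < 6 := by
  have hπ := Real.pi_lt_d4
  have hπ0 := Real.pi_pos
  have hs : Real.sqrt 2 < 1.4143 := by
    rw [Real.sqrt_lt' (by norm_num)]; norm_num
  have hs0 : 0 ≤ Real.sqrt 2 := Real.sqrt_nonneg 2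
  have h1 : 19 / 12 + (1 + Real.sqrt 2) / 8 < 1.8852 := by linarith
  have h2 : 0 < 19 / 12 + (1 + Real.sqrt 2) / 8 := by positivity
  calc Real.pi * (19 / 12 + (1 + Real.sqrt 2) / 8) < 3.1416 * 1.8852 := by nlinarith
    _ < 6 := by norm_num

/-- `cos(π/4) = √2/2` and `1/cos(π/4) = √2`. -/
theorem inv_cos_pi_div_four : 1 / Real.cos (Real.pi / 4) = Real.sqrt 2 := by
  rw [Real.cos_pi_div_four]
  have h2 : Real.sqrt 2 ≠ 0 := by positivity
  field_simp
  rw [Real.sq_sqrt (by norm_num)]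

/-! ### THEOREM 31.3: the three steps as algebra -/

/-- STEP 1 (Case `ε ≤ 1/2` on `(0,y_b]`): `log 2 ≤ (C₅X/(aA₀))(1 + 1/A₀)` with `A₀ > 5/2` forces
`X = C₀y_b ≥ (5 log 2/(7C₅))·aA₀`. -/
theorem half_retention_alg (C5 X a A0 : ℝ) (hC5 : 0 < C5) (hX : 0 ≤ X) (ha : 0 < a) (hA0 : 5 / 2 < A0)
    (h : Real.log 2 ≤ C5 * X / (a * A0) * (1 + 1 / A0)) :
    5 * Real.log 2 / (7 * C5) * (a * A0) ≤ X := by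
  have hA0pos : 0 < A0 := by linarith
  have h75 : 1 + 1 / A0 < 7 / 5 := by
    have : 1 / A0 < 2 / 5 := by rw [div_lt_div_iff₀ hA0pos (by norm_num)]; linarith
    linarith
  have hnum : 0 ≤ C5 * X / (a * A0) := by positivity
  have h2 : Real.log 2 ≤ C5 * X / (a * A0) * (7 / 5) := le_trans h (by nlinarith)
  have h3 : Real.log 2 * (a * A0) ≤ C5 * X * (7 / 5) := by
    rw [div_mul_eq_mul_div, le_div_iff₀ (by positivity)] at h2; linarith
  rw [div_mul_eq_mul_div, div_le_iff₀ (by positivity)]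
  nlinarith [h3]

/-- STEP 1 (Case `C₅C₀y_b > A₀/2`): then also `C₀y_b ≥ (5 log 2/(7C₅))·aA₀` (`a ≤ 1`, `log 2 < 0.7`). -/
theorem else_branch_alg (C5 X a A0 : ℝ) (hC5 : 0 < C5) (ha : 0 < a) (ha1 : a ≤ 1) (hA0 : 0 < A0)
    (h : A0 / 2 < C5 * X) : 5 * Real.log 2 / (7 * C5) * (a * A0) ≤ X := by
  have hlog := Real.log_two_lt_d9
  have h1 : 5 * Real.log 2 / 7 < 1 / 2 := by linarith
  rw [show 5 * Real.log 2 / (7 * C5) * (a * A0) = (5 * Real.log 2 / 7) * (a * A0) / C5 by field_simp]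
  rw [div_le_iff₀ hC5]
  have : (5 * Real.log 2 / 7) * (a * A0) ≤ (1 / 2) * (1 * A0) := by
    apply mul_le_mul h1.le _ (by positivity) (by norm_num)
    nlinarith
  nlinarith [this, h]

/-- STEP 2: the logarithmic budget `πA₀ ≥ 2F_b(log(x_m/y_b) − log(π/2))` with `F_b ≥ c_F·aA₀` bounds the climb:
`x_m/y_b ≤ (π/2)·exp(π/(2c_F a))`. -/
theorem climb_alg (A0 Fb cF a xm yb : ℝ) (hA0 : 0 < A0) (hcF : 0 < cF) (ha : 0 < a) (hxm : 0 < xm) (hyb : 0 < yb)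
    (hFb : cF * (a * A0) ≤ Fb)
    (h : 2 * Fb * (Real.log (xm / yb) - Real.log (Real.pi / 2)) ≤ Real.pi * A0) :
    xm / yb ≤ Real.pi / 2 * Real.exp (Real.pi / (2 * cF * a)) := by
  have hFbpos : 0 < Fb := lt_of_lt_of_le (by positivity) hFb
  have hπ := Real.pi_pos
  have h1 : Real.log (xm / yb) - Real.log (Real.pi / 2) ≤ Real.pi * A0 / (2 * Fb) := by
    rw [le_div_iff₀ (by positivity)]; linarith
  have h2 : Real.pi * A0 / (2 * Fb) ≤ Real.pi / (2 * cF * a) := by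
    rw [div_le_div_iff₀ (by positivity) (by positivity)]
    have : Real.pi * (cF * (a * A0)) ≤ Real.pi * Fb := mul_le_mul_of_nonneg_left hFb hπ.le
    nlinarith [this]
  have h3 : Real.log (xm / yb) ≤ Real.log (Real.pi / 2) + Real.pi / (2 * cF * a) := by linarith
  have h4 := Real.exp_le_exp.mpr h3
  rw [Real.exp_log (by positivity), Real.exp_add, Real.exp_log (by positivity)] at h4
  exact h4

/-- STEP 3: `t_m = C₀x_m/K_m ≤ 2x_m/y_b` when `K_m ≥ F(y_b) = C₀y_b/2`; with STEP 2, `t_m ≤ π·exp(π/(2c_F a))`. -/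
theorem tm_bound (C0 xm yb Km cF a : ℝ) (hC0 : 0 < C0) (hxm : 0 < xm) (hyb : 0 < yb) (hKm : C0 * yb / 2 ≤ Km)
    (hclimb : xm / yb ≤ Real.pi / 2 * Real.exp (Real.pi / (2 * cF * a))) :
    C0 * xm / Km ≤ Real.pi * Real.exp (Real.pi / (2 * cF * a)) := by
  have hKmpos : 0 < Km := lt_of_lt_of_le (by positivity) hKm
  have h1 : C0 * xm / Km ≤ 2 * (xm / yb) := by
    rw [div_le_iff₀ hKmpos]
    have : 2 * (xm / yb) * Km ≥ 2 * (xm / yb) * (C0 * yb / 2) :=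
      mul_le_mul_of_nonneg_left hKm (by positivity)
    have e : 2 * (xm / yb) * (C0 * yb / 2) = C0 * xm := by field_simp
    linarith [this, e]
  have hE : 0 < Real.exp (Real.pi / (2 * cF * a)) := Real.exp_pos _
  nlinarith [h1, hclimb, Real.pi_pos]

/-- `T(a) = π·e^{c/a} ≤ e^{(c + 3/2)/a}` for `0 < a ≤ 1`, `c ≥ 0` (since `π < e^{3/2}`). -/
theorem T_le_exp (c a : ℝ) (_hc : 0 ≤ c) (ha : 0 < a) (ha1 : a ≤ 1) :
    Real.pi * Real.exp (c / a) ≤ Real.exp ((c + 3 / 2) / a) := by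
  have hπ : Real.pi ≤ Real.exp (3 / 2) := by
    have e1 := Real.exp_one_gt_d9
    have e2 : (1:ℝ) + 1 / 2 ≤ Real.exp (1 / 2) := by
      have := Real.add_one_le_exp (1 / 2 : ℝ); linarith
    have e3 : Real.exp (3 / 2) = Real.exp 1 * Real.exp (1 / 2) := by
      rw [← Real.exp_add]; norm_num
    rw [e3]
    nlinarith [Real.pi_lt_d4, Real.exp_pos (1:ℝ), Real.exp_pos (1/2:ℝ)]
  have h32 : (3:ℝ) / 2 ≤ 3 / 2 / a := by
    rw [le_div_iff₀ ha]; nlinarith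
  calc Real.pi * Real.exp (c / a) ≤ Real.exp (3 / 2) * Real.exp (c / a) :=
        mul_le_mul_of_nonneg_right hπ (Real.exp_pos _).le
    _ ≤ Real.exp (3 / 2 / a) * Real.exp (c / a) :=
        mul_le_mul_of_nonneg_right (Real.exp_le_exp.mpr h32) (Real.exp_pos _).le
    _ = Real.exp ((c + 3 / 2) / a) := by rw [← Real.exp_add]; congr 1; field_simp; ring

/-- The numerical exponent: `π/c₆ + 3/2 < 50` with `c₆ = 5 log 2/(7C₅)`, `C₅ = π/2 + 6`, i.e.
`7π(π/2 + 6)/(5 log 2) + 3/2 < 50` (= 49.54). -/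
theorem exponent_lt_fifty : 7 * Real.pi * (Real.pi / 2 + 6) / (5 * Real.log 2) + 3 / 2 < 50 := by
  have hπ := Real.pi_lt_d4
  have hπ0 := Real.pi_pos
  have hlog := Real.log_two_gt_d9
  have hlogpos : 0 < Real.log 2 := by linarith
  have hnum : 7 * Real.pi * (Real.pi / 2 + 6) < 166.5 := by nlinarith
  have h1 : 7 * Real.pi * (Real.pi / 2 + 6) / (5 * Real.log 2) < 166.5 / (5 * 0.6931471803) := by
    apply lt_of_lt_of_le (div_lt_div_of_pos_right hnum (by positivity))
    apply div_le_div_of_nonneg_left (by norm_num) (by norm_num) (by linarith)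
  have h2 : (166.5 : ℝ) / (5 * 0.6931471803) < 48.1 := by norm_num
  linarith

/-! ### THEOREM 31.4 (M35): the sink floor, the location bound, the slope chain -/

/-- (i): `πB₀ ≤ (x₀²/2)·π(A₀+B₀)/2 + π·u(x₀)` with `x₀² = 2B₀/(A₀+B₀)` gives `u(x₀) ≥ B₀/2`. -/
theorem sink_floor_alg (A0 B0 x0sq ux0 : ℝ) (_hA0 : 0 < A0) (_hB0 : 0 < B0)
    (hx0 : x0sq = 2 * B0 / (A0 + B0))
    (h : Real.pi * B0 ≤ x0sq / 2 * (Real.pi * (A0 + B0) / 2) + Real.pi * ux0) : B0 / 2 ≤ ux0 := by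
  have hπ := Real.pi_pos
  have e : x0sq / 2 * (Real.pi * (A0 + B0) / 2) = Real.pi * B0 / 2 := by
    rw [hx0]; field_simp
  rw [e] at h
  nlinarith

/-- `x₀² = 2B₀/(A₀+B₀) < 1.23` when `B₀ < (π/2)A₀`; hence `x₀ < 1.11 < π/2`. -/
theorem x0_sq_lt (A0 B0 : ℝ) (hA0 : 0 < A0) (hB0 : 0 < B0) (hB : B0 < Real.pi / 2 * A0) :
    2 * B0 / (A0 + B0) < 1.23 := by
  have hπ := Real.pi_lt_d4
  rw [div_lt_iff₀ (by positivity)]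
  nlinarith

end Summit.NavierStokesRegularity.OSWSelfSimilar.Mechanism.SourceDefect
end
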